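import Literature.Analysis.FluidPDE.Tao2016AveragedNS.TriggerToleranceWith
import Literature.Analysis.FluidPDE.Tao2016AveragedNS.TriggerCeilingWith

/-!
# The trigger channel of the retuned family is two-sided and polynomial in `K`

Framing (page 1, mandatory): low prior, high value-of-information experiment on Tao's machine
paradigm; NOT a claim that NS blows up.

Assembly of the two sides of the trigger channel of `delayCircuitWith K M ε` under the standing
hypotheses of the family (`K ≥ K₀ = 2·20⁴²·42! + 16`, `3000 log K ≤ M ≤ K¹⁰`,
`0 < ε ≤ e^{-10M}/K¹⁰⁰`), for the kicked datum `kickInit κ = (√(1-κ²), 0, κ, 0, 0)`, `0 ≤ κ ≤ ε²`: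

* LOWER side (`TriggerToleranceWith.lean`, `kickTransitionWith_explicit`):
  `κ ≤ kickToleranceWith K M ε = ε²e^{-M}K¹⁰` ⇒ the input is quiet (`QuietUpTo (200/K¹⁰)`) up to
  `√2 - 44 log K/M` (`quietUpTo_of_le_kickToleranceWith`);
* UPPER side (`TriggerCeilingWith.lean`, `not_quietUpTo_of_kickCeilingWith_le`,
  `kickCeilingWith_le`): `κ ≥ 2e^{400M/K¹⁰+2}K⁶³ · kickToleranceWith K M ε` ⇒ the input is NOT
  quiet up to `√2 - 44 log K/M` (`not_quietUpTo_of_kickCeilingWith_le_std`, `kickCeilingWith_le_std`);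

together `triggerChannelWith`: the undetermined band of pre-loads spans a factor
`≤ 2e^{400M/K¹⁰+2}K⁶³ ≤ 2e⁴⁰²K⁶³` — polynomial in `K`, uniformly in `M` (on `M = p log K`,
`400p ≤ K⁹`: `≤ 2e³K⁶³`). Also `two_mul_kickToleranceWith_le_kickCeilingWith`: the ceiling is at
least twice the tolerance whenever the clock exponent is nonnegative (consistency of the two sides).
No named facts, no axioms, no new definitions.

## References

* [Tao2016AveragedNS] T. Tao, Finite time blowup for an averaged three-dimensional Navier–Stokes
  equation, J. Amer. Math. Soc. 29 (2016), Theorem 5.3 and §5.5, (5.5)–(5.6), pp. 28–30.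
-/

noncomputable section

namespace Literature.Analysis.FluidPDE.Tao2016AveragedNS

open Set Real Filter
open _root_.Topology

section Consistency

variable {K M ε : ℝ}

/-- **Twice the tolerance is below the ceiling** whenever the clock rate `1 - 2γ - 4MK²⁰ε²` lies in
`[0, 1]` and `s² ≤ 2` (`M ≥ 0`): the two sides of the trigger channel are consistent.
[cite: Tao2016AveragedNS, §5.5] -/
theorem two_mul_kickToleranceWith_le_kickCeilingWith (hM : 0 ≤ M) {γ s : ℝ}
    (hr0 : 2 * γ + 4 * M * K ^ 20 * ε ^ 2 ≤ 1) (hr1 : 0 ≤ 2 * γ + 4 * M * K ^ 20 * ε ^ 2)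
    (hs : s ^ 2 ≤ 2) : 2 * kickToleranceWith K M ε ≤ kickCeilingWith K M ε γ s := by
  unfold kickToleranceWith kickCeilingWith
  have hr : 0 ≤ 1 - 2 * γ - 4 * M * K ^ 20 * ε ^ 2 := by linarith
  have hr' : 1 - 2 * γ - 4 * M * K ^ 20 * ε ^ 2 ≤ 1 := by linarith
  have hE : M * (1 - 2 * γ - 4 * M * K ^ 20 * ε ^ 2) * s ^ 2 / 2 ≤ M := by
    have h1 : M * (1 - 2 * γ - 4 * M * K ^ 20 * ε ^ 2) * s ^ 2
        ≤ M * (1 - 2 * γ - 4 * M * K ^ 20 * ε ^ 2) * 2 :=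
      mul_le_mul_of_nonneg_left hs (mul_nonneg hM hr)
    have h2 : M * (1 - 2 * γ - 4 * M * K ^ 20 * ε ^ 2) ≤ M * 1 := mul_le_mul_of_nonneg_left hr' hM
    linarith
  have hexp : exp (-M) ≤ exp (-(M * (1 - 2 * γ - 4 * M * K ^ 20 * ε ^ 2) * s ^ 2 / 2)) :=
    exp_le_exp.2 (by linarith)
  calc 2 * (ε ^ 2 * exp (-M) * K ^ 10) = 2 * K ^ 10 * ε ^ 2 * exp (-M) := by ring
    _ ≤ 2 * K ^ 10 * ε ^ 2 * exp (-(M * (1 - 2 * γ - 4 * M * K ^ 20 * ε ^ 2) * s ^ 2 / 2)) :=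
        mul_le_mul_of_nonneg_left hexp (by positivity)

end Consistency

/-! ## The two sides at the quiet phase of Theorem 5.3 (standing hypotheses of the family) -/

/-- LOWER SIDE (from `kickTransitionWith_explicit`): a pre-load `κ ≤ kickToleranceWith K M ε =
ε²e^{-M}K¹⁰` keeps every member of the family quiet (tolerance `200K⁻¹⁰`) up to time
`√2 - 44 log K/M`. [cite: Tao2016AveragedNS, Theorem 5.3] -/
theorem quietUpTo_of_le_kickToleranceWith {K M ε κ : ℝ} {X : ℝ → Fin 5 → ℝ}
    (hK : 2 * 20 ^ 42 * (Nat.factorial 42 : ℝ) + 16 ≤ K) (hML : 3000 * Real.log K ≤ M)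
    (hMK : M ≤ K ^ 10) (hε : 0 < ε) (hεle : ε ≤ exp (-(10 * M)) / K ^ 100) (hκ0 : 0 ≤ κ)
    (hκ : κ ≤ kickToleranceWith K M ε) (h0 : X 0 = kickInit κ)
    (hX : ∀ t, HasDerivAt X (delayCircuitWith K M ε (X t)) t) :
    QuietUpTo (200 / K ^ 10) (Real.sqrt 2 - 44 * Real.log K / M) X := by
  obtain ⟨tc, htc, hq, -⟩ := kickTransitionWith_explicit hK hML hMK hε hεle hκ0 hκ h0 hX
  intro t ht
  exact hq t ⟨ht.1, ht.2.trans (by have := (abs_le.1 htc).1; linarith)⟩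

/-- Arithmetic of the standing hypotheses used by the upper side. [folklore] -/
theorem ceiling_params {K M ε : ℝ} (hK : 2 * 20 ^ 42 * (Nat.factorial 42 : ℝ) + 16 ≤ K)
    (hML : 3000 * Real.log K ≤ M) (hMK : M ≤ K ^ 10) (hε : 0 < ε)
    (hεle : ε ≤ exp (-(10 * M)) / K ^ 100) :
    16 ≤ K ∧ 1 ≤ M ∧ ε ≤ 1 ∧ 169 * M * K ^ 20 * ε ^ 2 ≤ 1 ∧ 8 * M ^ 2 * K ^ 20 * ε ^ 2 ≤ 1 ∧
      200 / K ^ 10 ≤ 1 / 8 ∧ 1 / (2 * K ^ 10) < Real.sqrt 2 - 44 * Real.log K / M ∧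
      Real.sqrt 2 - 44 * Real.log K / M ≤ 2 := by
  have hK16 : 16 ≤ K := by
    have : (0 : ℝ) ≤ 2 * 20 ^ 42 * (Nat.factorial 42 : ℝ) := by positivity
    linarith
  have hK0 : 0 < K := by linarith
  have hK1 : 1 ≤ K := by linarith
  obtain ⟨hlog2, -, hlog0⟩ := Thm53With.log_facts hK16
  have hM0 : 0 < M := by linarith
  have hM1 : 1 ≤ M := by linarith
  obtain ⟨hε1, -, hε100, -⟩ := Thm53With.eps_facts hK16 hM0 hMK hε hεle
  have hεsq : ε ^ 2 ≤ (1 / K ^ 100) ^ 2 := pow_le_pow_left₀ hε.le hε100 2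
  have hK170 : (169 : ℝ) ≤ K ^ 170 := le_trans (by norm_num) (pow_le_pow_left₀ (by norm_num) hK16 170)
  have hK160 : (8 : ℝ) ≤ K ^ 160 := le_trans (by norm_num) (pow_le_pow_left₀ (by norm_num) hK16 160)
  have h169 : 169 * M * K ^ 20 * ε ^ 2 ≤ 1 := by
    calc 169 * M * K ^ 20 * ε ^ 2 ≤ 169 * K ^ 10 * K ^ 20 * (1 / K ^ 100) ^ 2 := by
          have h3 : 169 * M * K ^ 20 ≤ 169 * K ^ 10 * K ^ 20 :=
            mul_le_mul_of_nonneg_right (mul_le_mul_of_nonneg_left hMK (by norm_num)) (by positivity)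
          exact mul_le_mul h3 hεsq (by positivity) (by positivity)
      _ = 169 * K ^ 30 / K ^ 200 := by field_simp
      _ ≤ 1 := by
          rw [div_le_one (by positivity)]
          calc (169 : ℝ) * K ^ 30 ≤ K ^ 170 * K ^ 30 := mul_le_mul_of_nonneg_right hK170 (by positivity)
            _ = K ^ 200 := by ring
  have h8 : 8 * M ^ 2 * K ^ 20 * ε ^ 2 ≤ 1 := by
    have hM2 : M ^ 2 ≤ (K ^ 10) ^ 2 := pow_le_pow_left₀ hM0.le hMK 2
    calc 8 * M ^ 2 * K ^ 20 * ε ^ 2 ≤ 8 * (K ^ 10) ^ 2 * K ^ 20 * (1 / K ^ 100) ^ 2 := by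
          have h3 : 8 * M ^ 2 * K ^ 20 ≤ 8 * (K ^ 10) ^ 2 * K ^ 20 :=
            mul_le_mul_of_nonneg_right (mul_le_mul_of_nonneg_left hM2 (by norm_num)) (by positivity)
          exact mul_le_mul h3 hεsq (by positivity) (by positivity)
      _ = 8 * K ^ 40 / K ^ 200 := by field_simp
      _ ≤ 1 := by
          rw [div_le_one (by positivity)]
          calc (8 : ℝ) * K ^ 40 ≤ K ^ 160 * K ^ 40 := mul_le_mul_of_nonneg_right hK160 (by positivity)
            _ = K ^ 200 := by ring
  have hγ : 200 / K ^ 10 ≤ 1 / 8 := by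
    rw [div_le_div_iff₀ (by positivity) (by norm_num)]
    have : (1600 : ℝ) ≤ K ^ 10 := le_trans (by norm_num) (pow_le_pow_left₀ (by norm_num) hK16 10)
    linarith
  have h44 : 0 ≤ 44 * Real.log K / M := by positivity
  have h44' : 44 * Real.log K / M ≤ 44 / 3000 := by
    rw [div_le_div_iff₀ hM0 (by norm_num)]; linarith
  have hΔ : 1 / (2 * K ^ 10) ≤ 1 / 2 := by
    apply one_div_le_one_div_of_le (by norm_num)
    have := one_le_pow₀ (M₀ := ℝ) (n := 10) hK1
    linarith
  have hs2 := Thm53.sqrt_two_gt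
  have hs2' := Thm53.sqrt_two_lt
  exact ⟨hK16, hM1, hε1, h169, h8, hγ, by linarith, by linarith⟩

/-- UPPER SIDE: under the standing hypotheses of the family (`K ≥ K₀`, `3000 log K ≤ M ≤ K¹⁰`,
`0 < ε ≤ e^{-10M}K⁻¹⁰⁰`), a pre-load `κ` with
`kickCeilingWith K M ε (200K⁻¹⁰) (√2 - 44 log K/M - 1/(2K¹⁰)) ≤ κ ≤ ε²` makes EVERY global
solution from `kickInit κ` violate the quiet bounds (tolerance `200K⁻¹⁰`) before time
`√2 - 44 log K/M`: the gate fires early. [cite: Tao2016AveragedNS, §5.5 proof] -/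
theorem not_quietUpTo_of_kickCeilingWith_le_std {K M ε κ : ℝ} {X : ℝ → Fin 5 → ℝ}
    (hK : 2 * 20 ^ 42 * (Nat.factorial 42 : ℝ) + 16 ≤ K) (hML : 3000 * Real.log K ≤ M)
    (hMK : M ≤ K ^ 10) (hε : 0 < ε) (hεle : ε ≤ exp (-(10 * M)) / K ^ 100) (hκ : κ ≤ ε ^ 2)
    (hthr : kickCeilingWith K M ε (200 / K ^ 10)
      (Real.sqrt 2 - 44 * Real.log K / M - 1 / (2 * K ^ 10)) ≤ κ)
    (h0 : X 0 = kickInit κ) (hX : ∀ t, HasDerivAt X (delayCircuitWith K M ε (X t)) t) :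
    ¬ QuietUpTo (200 / K ^ 10) (Real.sqrt 2 - 44 * Real.log K / M) X := by
  obtain ⟨hK16, hM1, hε1, h169, -, hγ, hT, hT2⟩ := ceiling_params hK hML hMK hε hεle
  have hK0 : 0 < K := by linarith
  have hκ0 : 0 < κ := (kickCeilingWith_pos hK0 hε _ _).trans_le hthr
  exact not_quietUpTo_of_kickCeilingWith_le hX h0 (by linarith) (by linarith) hMK hε hε1 h169 hκ0
    hκ hγ hT hT2 hthr

/-- UPPER SIDE, size: under the standing hypotheses the ceiling at the Theorem-5.3 quiet phase is
`≤ 2e^{400M/K¹⁰+2}K⁶³ × kickToleranceWith K M ε` (`≤ 2e^{402}K⁶³ ×` tolerance over the whole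
family, `≤ 2e³K⁶³ ×` tolerance for `400M ≤ K¹⁰`). [cite: Tao2016AveragedNS, §5.5] -/
theorem kickCeilingWith_le_std {K M ε : ℝ} (hK : 2 * 20 ^ 42 * (Nat.factorial 42 : ℝ) + 16 ≤ K)
    (hML : 3000 * Real.log K ≤ M) (hMK : M ≤ K ^ 10) (hε : 0 < ε)
    (hεle : ε ≤ exp (-(10 * M)) / K ^ 100) :
    kickCeilingWith K M ε (200 / K ^ 10) (Real.sqrt 2 - 44 * Real.log K / M - 1 / (2 * K ^ 10))
      ≤ 2 * exp (400 * M / K ^ 10 + 2) * K ^ 63 * kickToleranceWith K M ε := by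
  obtain ⟨hK16, hM1, -, -, h8, -⟩ := ceiling_params hK hML hMK hε hεle
  have h := kickCeilingWith_le (ε := ε) (by linarith) hM1 hMK hε h8
  calc _ ≤ 2 * exp (400 * M / K ^ 10 + 2) * K ^ 73 * (ε ^ 2 * exp (-M)) := h
    _ = 2 * exp (400 * M / K ^ 10 + 2) * K ^ 63 * kickToleranceWith K M ε := by
        unfold kickToleranceWith; ring

/-- **The trigger channel of the retuned family, both sides** (standing hypotheses; every global
solution from `kickInit κ`, `0 ≤ κ ≤ ε²`): quiet up to `√2 - 44 log K/M` if
`κ ≤ kickToleranceWith K M ε`, NOT quiet up to `√2 - 44 log K/M` if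
`κ ≥ 2e^{400M/K¹⁰+2}K⁶³ · kickToleranceWith K M ε`. The undetermined band is a factor
`2e^{400M/K¹⁰+2}K⁶³` wide — polynomial in `K`. [cite: Tao2016AveragedNS, Theorem 5.3, §5.5] -/
theorem triggerChannelWith {K M ε κ : ℝ} {X : ℝ → Fin 5 → ℝ}
    (hK : 2 * 20 ^ 42 * (Nat.factorial 42 : ℝ) + 16 ≤ K) (hML : 3000 * Real.log K ≤ M)
    (hMK : M ≤ K ^ 10) (hε : 0 < ε) (hεle : ε ≤ exp (-(10 * M)) / K ^ 100) (hκ0 : 0 ≤ κ)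
    (hκ : κ ≤ ε ^ 2) (h0 : X 0 = kickInit κ)
    (hX : ∀ t, HasDerivAt X (delayCircuitWith K M ε (X t)) t) :
    (κ ≤ kickToleranceWith K M ε → QuietUpTo (200 / K ^ 10) (Real.sqrt 2 - 44 * Real.log K / M) X) ∧
    (2 * exp (400 * M / K ^ 10 + 2) * K ^ 63 * kickToleranceWith K M ε ≤ κ →
      ¬ QuietUpTo (200 / K ^ 10) (Real.sqrt 2 - 44 * Real.log K / M) X) :=
  ⟨fun h => quietUpTo_of_le_kickToleranceWith hK hML hMK hε hεle hκ0 h h0 hX,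
   fun h => not_quietUpTo_of_kickCeilingWith_le_std hK hML hMK hε hεle hκ
    ((kickCeilingWith_le_std hK hML hMK hε hεle).trans h) h0 hX⟩

end Literature.Analysis.FluidPDE.Tao2016AveragedNS

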